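import Summits.BirchSwinnertonDyer.Rank1Residual.GaloisImage.KolyvaginDerivativeCocycleWitnesses
import HarnessLib

/-!
# The value of the Kolyvagin derivative cocycle at the tame generator (Nekovář / Perrin-Riou,
# *Systèmes d'Euler p-adiques*, §3.1.2) — file C2 of THEOREM C of row T-DER
# ([Rubin00] Thm. 4.5.4, the finite–singular relation; cell `b2b-bsdres`, team n1011, seat p11
# GEN 8, OWNERS row T-DER = skel/T-DER.md STATUS v8)

HONEST FRAMING (cell `b2b-bsdres`, run/shared/lean/b2b/bsd-rank1-residual/, verbatim in every
file): the goal of the cell is to DELETE the COMBINATION-SHAPED residual classes of the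
Birch–Swinnerton-Dyer formula for ALL analytic-rank `≤ 1` elliptic curves over `ℚ` — "full BSD
formula for every rank `≤ 1` curve in class `C`" assembled STRICTLY from published theorems — so
that the rank-`≤ 1` remainder becomes exactly the CONSTRUCTION-SHAPED classes, which are TYPED
(missing-input `Prop`s), NOT attempted. This is not "finishing BSD". Team n1011: research route on
the CONSTRUCTION-SHAPED class X4 / §I N11 (route-1 PORT, (P-DER)); TOOL theorems of continuous
group cohomology (no definition, no named fact, no `sorry`); curve-free, `p`-free.

## What ([PerrinRiou98] §3.1.2, the cohomological form of [Rubin00] §4.7)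

Setting: a topological representation `X` of `G` (the `W_M = T/MT` of the application), a normal
subgroup `N` (`= Gal(K̄/F(rq))`), an element `σ ∈ G` (the tame generator `τ = σ_q`) with
`σ^{N_q} ∈ N` and `N_q · X = 0` (`M ∣ [F(q):K]`), an `N`-cocycle `y` (`= D_r x_{rq}`), and the
cocycle `Ψ = D_σ y := Σ_{i<N_q} i • σ^i·y` (pointwise: `Ψ(u) = Σ i • σ^i y(σ^{-i} u σ^i)`).
* `rho_apply_deriv_sub_eq` — **the coboundary behind THEOREM A2, exactly**: if the norm of `y` is
  a coboundary ON THE NOSE, `Σ_{i<N_q} σ^i y(σ^{-i} u σ^i) = u·a − a` for all `u ∈ N`, and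
  `y(σ^{N_q}) = σ a − a`, then `σ·Ψ(σ⁻¹ u σ) − Ψ(u) = u·(−σa) − (−σa)` for all `u ∈ N`
  ([PerrinRiou98] §3.1.2: "`σ̃(Dx) − Dx = −(h−1) σ̃ a`"; telescoping `(σ−1)D = (N−1)σ^N + 1 − Tr` on
  cocycles, the inner formula for `σ^{N_q} ∈ N`, and `N_q X = 0`);
* `apply_eq_neg_rho_of_norm_eq_coboundary` — hence, if `X^N = 0`, EVERY global cocycle `Φ`
  extending `Ψ` has `Φ(σ) = −σ a` (C1's `apply_eq_of_forall_witness`): **the value of the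
  derivative class `κ` at `σ` is minus the norm witness** ([PerrinRiou98] §3.1.2:
  "`f(σ̃) = −σ̃ a`", `kol([x])`);
* `apply_eq_neg_of_norm_eq_coboundary` — for `σ` acting trivially on `X` (an inertia element at
  `q ∤ pN`): `Φ(σ) = −a`, the clause at `σ^{N_q}` becoming `y(σ^{N_q}) = 0`;
* `sum_rho_pow_apply_subgroupConj_eq_nsmul` — the companion evaluation of the norm at an element
  `φ ∈ N` normalised by `σ` up to elements killed by `y` (a Frobenius at `q`, `σ` inertial, `y`
  vanishing on inertia): `Σ_{i<N_q} σ^i y(σ^{-i} φ σ^i) = N_q • y(φ)` — the left side of the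
  `T`-level evaluation `N_q y(φ) = P(Fr⁻¹) y_r(φ) + (φ − 1) ã` ([PerrinRiou98] Prop. 3.1.6) by
  which file C3 identifies `a` (via the congruence [PerrinRiou98] Prop. 2.2.5).
THEOREM C for the Euler system then reads `κ_{rq}(τ) = −a = Fr⁻¹ Q_q(Fr⁻¹) κ_r(Fr)` once `a` is
identified (files C0/C3: the congruence and the assembly; skel/T-DER.md STATUS v8).

References: B. Perrin-Riou, Ann. Inst. Fourier 48 (1998), §3.1.2, Prop. 3.1.6; J. Nekovář,
*Kolyvagin's method for Chow groups of Kuga–Sato varieties*, Invent. math. 107 (1992), §§5–6;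
K. Rubin, *Euler Systems* (2000), §4.7.
-/

noncomputable section

open CategoryTheory Function Finset Field
open Literature.NumberTheory.GaloisRepresentations
open Literature.NumberTheory.EllipticCurves (subgroupConj subgroupConj_apply_coe subgroupConj_one)

universe u v

namespace Summit.BirchSwinnertonDyer.Rank1Residual.GaloisImage

namespace Derivative

section SingularValue

variable {R : Type v} [CommRing R] [TopologicalSpace R]
variable {G : Type u} [Group G] [TopologicalSpace G] [IsTopologicalGroup G]
variable (X : TopRep.{u} R G) (N : Subgroup G) [N.Normal]

omit [TopologicalSpace G] [IsTopologicalGroup G] in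
/-- Powers of an element acting trivially act trivially. [folklore] -/
theorem rho_pow_apply_of_rho_eq {σ : G} (hσ : ∀ w : X, X.ρ σ w = w) (i : ℕ) (w : X) :
    X.ρ (σ ^ i) w = w := by
  induction i with
  | zero => rw [pow_zero, map_one]; rfl
  | succ i ih => rw [pow_succ, ρ_mul_apply, hσ, ih]

/-- The `0`-th conjugate is the cocycle itself: `σ^0 · y (u) = y(u)`. [folklore] -/
theorem rho_pow_zero_apply_subgroupConj (σ : G) (y : contOneCocycles (subgroupRep X N)) (u : N) :
    X.ρ (σ ^ 0) (y.1 (subgroupConj N (σ ^ 0) u)) = y.1 u := by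
  rw [pow_zero, map_one, subgroupConj_one]
  rfl

/-- The `N_q`-th conjugate for `σ^{N_q} ∈ N` (inner formula, F4 `conj_sub_eq_of_mem`):
`σ^{N_q} y(σ^{-N_q} u σ^{N_q}) = y(u) + (u·y(σ^{N_q}) − y(σ^{N_q}))`. [folklore] -/
theorem rho_pow_apply_subgroupConj_of_mem (σ : G) {Nq : ℕ} (hσN : σ ^ Nq ∈ N)
    (y : contOneCocycles (subgroupRep X N)) (u : N) :
    X.ρ (σ ^ Nq) (y.1 (subgroupConj N (σ ^ Nq) u)) =
      y.1 u + (X.ρ (u : G) (y.1 ⟨σ ^ Nq, hσN⟩) - y.1 ⟨σ ^ Nq, hσN⟩) := by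
  rw [← conj_sub_eq_of_mem X N y ⟨σ ^ Nq, hσN⟩ u, add_sub_cancel]

/-- **The coboundary behind THEOREM A2, exactly** ([PerrinRiou98] §3.1.2,
"`σ̃(Dx) − Dx = −(h − 1)σ̃a`").  If the norm of the `N`-cocycle `y` along the powers of `σ` is the
coboundary of `a` ON THE NOSE (`Σ_{i<N_q} σ^i y(σ^{-i} u σ^i) = u a − a` on `N`, and
`y(σ^{N_q}) = σ a − a`), and `N_q X = 0`, then the derivative cocycle
`Ψ(u) = Σ_{i<N_q} i • σ^i y(σ^{-i} u σ^i)` satisfies `σ·Ψ(σ⁻¹uσ) − Ψ(u) = u(−σa) − (−σa)`.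
[cite: PerrinRiou1998AIF, §3.1.2] -/
theorem rho_apply_deriv_sub_eq (σ : G) {Nq : ℕ} (hσN : σ ^ Nq ∈ N)
    (hNX : ∀ w : X, (Nq : ℤ) • w = 0) (y : contOneCocycles (subgroupRep X N)) (a : X)
    (hcor : ∀ u : N,
      ∑ i ∈ range Nq, X.ρ (σ ^ i) (y.1 (subgroupConj N (σ ^ i) u)) = X.ρ (u : G) a - a)
    (hσNa : y.1 ⟨σ ^ Nq, hσN⟩ = X.ρ σ a - a)
    (Ψ : contOneCocycles (subgroupRep X N))
    (hΨ : ∀ u : N,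
      Ψ.1 u = ∑ i ∈ range Nq, (i : ℤ) • X.ρ (σ ^ i) (y.1 (subgroupConj N (σ ^ i) u)))
    (u : N) :
    X.ρ σ (Ψ.1 (subgroupConj N σ u)) - Ψ.1 u = X.ρ (u : G) (-(X.ρ σ a)) - -(X.ρ σ a) := by
  -- `σ Ψ(σ⁻¹ u σ) = Σ i • t(i+1)` with `t(i) = σ^i y(σ^{-i} u σ^i)`
  set t : ℕ → X := fun i => X.ρ (σ ^ i) (y.1 (subgroupConj N (σ ^ i) u)) with ht
  have hshift : X.ρ σ (Ψ.1 (subgroupConj N σ u)) = ∑ i ∈ range Nq, (i : ℤ) • t (i + 1) := by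
    rw [hΨ, map_sum]
    refine sum_congr rfl fun i _ => ?_
    rw [map_zsmul, ht, rho_rho_pow_apply_subgroupConj]
  have htel := sum_zsmul_sub_telescope t Nq
  have ht0 : t 0 = y.1 u := rho_pow_zero_apply_subgroupConj X N σ y u
  have htN : t Nq = y.1 u + (X.ρ (u : G) (X.ρ σ a - a) - (X.ρ σ a - a)) := by
    rw [ht]; dsimp only; rw [rho_pow_apply_subgroupConj_of_mem X N σ hσN y u, hσNa]
  have hsum : ∑ i ∈ range Nq, t i = X.ρ (u : G) a - a := hcor u
  have hkill : ((Nq : ℤ) - 1) • t Nq = -t Nq := by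
    rw [sub_smul, one_smul, hNX, zero_sub]
  rw [hshift, hΨ u, ← sum_sub_distrib]
  simp_rw [← smul_sub]
  rw [htel, hkill, ht0, hsum, htN]
  simp only [map_sub, map_neg]
  abel

/-- **The value of the derivative class at `σ` is minus the norm witness** ([PerrinRiou98]
§3.1.2, "`f(σ̃) = −σ̃ a`"): in the situation of `rho_apply_deriv_sub_eq`, if `X^N = 0` then EVERY
global continuous cocycle `Φ` extending the derivative cocycle `Ψ` has `Φ(σ) = −σ a`.
[cite: PerrinRiou1998AIF, §3.1.2] -/
theorem apply_eq_neg_rho_of_norm_eq_coboundary (σ : G) {Nq : ℕ} (hσN : σ ^ Nq ∈ N)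
    (hNX : ∀ w : X, (Nq : ℤ) • w = 0)
    (h0 : ∀ v : X, (∀ n : N, X.ρ (n : G) v = v) → v = 0)
    (y : contOneCocycles (subgroupRep X N)) (a : X)
    (hcor : ∀ u : N,
      ∑ i ∈ range Nq, X.ρ (σ ^ i) (y.1 (subgroupConj N (σ ^ i) u)) = X.ρ (u : G) a - a)
    (hσNa : y.1 ⟨σ ^ Nq, hσN⟩ = X.ρ σ a - a)
    (Ψ : contOneCocycles (subgroupRep X N))
    (hΨ : ∀ u : N,
      Ψ.1 u = ∑ i ∈ range Nq, (i : ℤ) • X.ρ (σ ^ i) (y.1 (subgroupConj N (σ ^ i) u)))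
    (Φ : contOneCocycles X) (hΦ : ∀ u : N, Φ.1 u = Ψ.1 u) :
    Φ.1 σ = -(X.ρ σ a) :=
  apply_eq_of_forall_witness X N h0 Φ σ _ fun u => by
    rw [hΦ, hΦ]
    exact rho_apply_deriv_sub_eq X N σ hσN hNX y a hcor hσNa Ψ hΨ u

/-- **THEOREM C, generic half** ([PerrinRiou98] §3.1.2 with `σ` inertial): if moreover `σ` acts
trivially on `X` (a tame inertia element at `q ∤ pN` on `W_M`), the clause at `σ^{N_q}` reads
`y(σ^{N_q}) = 0` and the value is `Φ(σ) = −a`: the singular part of the derivative class at `q`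
is MINUS THE NORM WITNESS of `y = D_r x_{rq}`.  Files C0/C3 identify `a` for an Euler system
(`a = −Fr⁻¹ Q_q(Fr⁻¹) κ_r(Fr)` by the congruence [PerrinRiou98] Prop. 2.2.5).
[cite: PerrinRiou1998AIF, §3.1.2] -/
theorem apply_eq_neg_of_norm_eq_coboundary (σ : G) (hσ : ∀ w : X, X.ρ σ w = w) {Nq : ℕ}
    (hσN : σ ^ Nq ∈ N) (hNX : ∀ w : X, (Nq : ℤ) • w = 0)
    (h0 : ∀ v : X, (∀ n : N, X.ρ (n : G) v = v) → v = 0)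
    (y : contOneCocycles (subgroupRep X N)) (a : X)
    (hcor : ∀ u : N,
      ∑ i ∈ range Nq, X.ρ (σ ^ i) (y.1 (subgroupConj N (σ ^ i) u)) = X.ρ (u : G) a - a)
    (hyN : y.1 ⟨σ ^ Nq, hσN⟩ = 0)
    (Ψ : contOneCocycles (subgroupRep X N))
    (hΨ : ∀ u : N,
      Ψ.1 u = ∑ i ∈ range Nq, (i : ℤ) • X.ρ (σ ^ i) (y.1 (subgroupConj N (σ ^ i) u)))
    (Φ : contOneCocycles X) (hΦ : ∀ u : N, Φ.1 u = Ψ.1 u) :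
    Φ.1 σ = -a := by
  have h := apply_eq_neg_rho_of_norm_eq_coboundary X N σ hσN hNX h0 y a hcor
    (by rw [hyN, hσ, sub_self]) Ψ hΨ Φ hΦ
  rwa [hσ] at h

/-! ### The companion evaluation at a Frobenius -/

/-- **Evaluating the norm at a Frobenius** ([PerrinRiou98] Prop. 3.1.6, left side): if `σ` acts
trivially on `X` and `y` kills the elements `φ⁻¹ · σ^{-i} φ σ^{i}` of `N` (for `σ` inertial and
`φ` in the decomposition group these are inertia elements, on which an unramified `y` vanishes),
then `Σ_{i<N_q} σ^i y(σ^{-i} φ σ^i) = N_q • y(φ)`. [cite: PerrinRiou1998AIF, Prop. 3.1.6] -/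
theorem sum_rho_pow_apply_subgroupConj_eq_nsmul (σ : G) (hσ : ∀ w : X, X.ρ σ w = w) (Nq : ℕ)
    (y : contOneCocycles (subgroupRep X N)) (φ : N)
    (hkill : ∀ i : ℕ, y.1 (φ⁻¹ * subgroupConj N (σ ^ i) φ) = 0) :
    ∑ i ∈ range Nq, X.ρ (σ ^ i) (y.1 (subgroupConj N (σ ^ i) φ)) = Nq • y.1 φ := by
  have hterm : ∀ i ∈ range Nq, X.ρ (σ ^ i) (y.1 (subgroupConj N (σ ^ i) φ)) = y.1 φ := by
    intro i _
    have hmul : subgroupConj N (σ ^ i) φ = φ * (φ⁻¹ * subgroupConj N (σ ^ i) φ) := by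
      rw [mul_inv_cancel_left]
    rw [hmul, subgroup_cocycle_mul, hkill i, map_zero, add_zero, rho_pow_apply_of_rho_eq X hσ]
  rw [sum_congr rfl hterm, sum_const, card_range]

end SingularValue

end Derivative

end Summit.BirchSwinnertonDyer.Rank1Residual.GaloisImage

end
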